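import Literature.AlgebraicGeometry.Resolution.AlterationsFibrations
import Literature.AlgebraicGeometry.Resolution.AlterationsReductionHolds
import HarnessLib

/-!
# De Jong's alteration theorem: the trust base after the split at 4.12

Topic: `Literature/AlgebraicGeometry/Resolution`. `AlterationsReductionHolds.lean` proves the
preliminary reductions 4.6–4.10 of de Jong 1996, Thm. 4.1 unconditionally
(`DeJong1996NormalProjectiveReduction_holds`), so that Thm. 4.1 over algebraically closed fields
rests on `DeJong1996NormalProjectiveStep` (4.11–4.28) alone (`DeJong1996StrongAlgClosed.of_step`);
`AlterationsFibrations.lean` splits that step at 4.12 into `DeJong1996FibrationReduction` (the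
pencil Lemma 4.11 with the Stein factorisation 4.12: fibring a normal projective pair in curves)
and `DeJong1996NormalProjectiveStepVI` (4.13–4.28) and proves
`DeJong1996NormalProjectiveStep.of_fibration_of_stepVI`. This file records the resulting
assemblies without the (no longer needed) projectivity of blow-ups:

* `DeJong1996InductionStep.of_fibration_of_stepVI`,
  `DeJong1996StrongAlgClosed.of_fibration_of_stepVI` — Thm. 4.1 with its generically-étale
  clause over algebraically closed fields from the two named facts 4.11–4.12 and 4.13–4.28;
* `DeJong1996Strong.of_descent_of_fibration_of_stepVI`,
  `DeJong1996StrongPerfect.of_descent_of_fibration_of_stepVI` (with 4.5, `DeJong1996Descent`),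
  and `DeJong1996Strong.of_finiteSubextension45_of_fibration_of_stepVI`,
  `DeJong1996Projective.of_finiteSubextension45_of_fibration_of_stepVI` (with the limit
  argument `DeJong1996.FiniteSubextension45` of `AlterationsDescent.lean`) — the current trust
  base of Thm. 4.1 (i)+(ii): `FiniteSubextension45`, `DeJong1996FibrationReduction`,
  `DeJong1996NormalProjectiveStepVI`.

## Sources

* A. J. de Jong, *Smoothness, semi-stability and alterations*, Publ. Math. IHÉS 83 (1996) 51–93:
  Thm. 4.1, 4.3–4.12 (pp. 66–69), 4.13–4.28 (pp. 69–76).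
-/

noncomputable section

namespace Literature.AlgebraicGeometry.Resolution

universe u

/-- **The induction step of Thm. 4.1 from 4.11–4.12 and 4.13–4.28** (de Jong 1996), the
reductions 4.6–4.10 being proved (`DeJong1996InductionStep.of_step`).
[cite: DeJong1996, 4.11–4.12, pp. 67–69] -/
theorem DeJong1996InductionStep.of_fibration_of_stepVI (h₁ : DeJong1996FibrationReduction.{u})
    (h₂ : DeJong1996NormalProjectiveStepVI.{u}) : DeJong1996InductionStep.{u} :=
  DeJong1996InductionStep.of_step (DeJong1996NormalProjectiveStep.of_fibration_of_stepVI h₁ h₂)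

/-- **`DeJong1996StrongAlgClosed` — Thm. 4.1 with its generically-étale clause over algebraically
closed fields — from the two named facts `DeJong1996FibrationReduction` (Lemma 4.11 with 4.12)
and `DeJong1996NormalProjectiveStepVI` (4.13–4.28)**; 4.3, 4.4, 4.6–4.10 and the induction on
`dim X` are proved. [cite: DeJong1996, 4.3–4.12, pp. 66–69] -/
theorem DeJong1996StrongAlgClosed.of_fibration_of_stepVI (h₁ : DeJong1996FibrationReduction.{u})
    (h₂ : DeJong1996NormalProjectiveStepVI.{u}) : DeJong1996StrongAlgClosed.{u} :=
  DeJong1996StrongAlgClosed.of_step (DeJong1996NormalProjectiveStep.of_fibration_of_stepVI h₁ h₂)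

/-- Thm. 4.1 (i)+(ii) over every field from 4.5 (`DeJong1996Descent`), 4.11–4.12 and 4.13–4.28.
[cite: DeJong1996, 4.3–4.12, pp. 66–69] -/
theorem DeJong1996Strong.of_descent_of_fibration_of_stepVI (h45 : DeJong1996Descent.{u})
    (h₁ : DeJong1996FibrationReduction.{u}) (h₂ : DeJong1996NormalProjectiveStepVI.{u}) :
    DeJong1996Strong.{u} :=
  DeJong1996Strong.of_descent_of_step h45 (DeJong1996NormalProjectiveStep.of_fibration_of_stepVI h₁ h₂)

/-- The last sentence of Thm. 4.1 (perfect fields) from the same inputs.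
[cite: DeJong1996, 4.3–4.12, pp. 66–69] -/
theorem DeJong1996StrongPerfect.of_descent_of_fibration_of_stepVI (h45 : DeJong1996Descent.{u})
    (h₁ : DeJong1996FibrationReduction.{u}) (h₂ : DeJong1996NormalProjectiveStepVI.{u}) :
    DeJong1996StrongPerfect.{u} :=
  DeJong1996StrongPerfect.of_descent_of_step h45
    (DeJong1996NormalProjectiveStep.of_fibration_of_stepVI h₁ h₂)

/-- **Thm. 4.1 (i)+(ii) and its last sentence from the three live nodes**: the limit argument of
4.5 (`DeJong1996.FiniteSubextension45`), Lemma 4.11 with 4.12 (`DeJong1996FibrationReduction`)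
and 4.13–4.28 (`DeJong1996NormalProjectiveStepVI`). [cite: DeJong1996, Thm. 4.1, p. 66] -/
theorem DeJong1996Strong.of_finiteSubextension45_of_fibration_of_stepVI
    (H : DeJong1996.FiniteSubextension45.{u}) (h₁ : DeJong1996FibrationReduction.{u})
    (h₂ : DeJong1996NormalProjectiveStepVI.{u}) :
    DeJong1996Strong.{u} ∧ DeJong1996StrongPerfect.{u} :=
  DeJong1996Strong.of_finiteSubextension45_of_step H
    (DeJong1996NormalProjectiveStep.of_fibration_of_stepVI h₁ h₂)

/-- `DeJong1996Projective` (Thm. 4.1 (i)) from the three live nodes.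
[cite: DeJong1996, Thm. 4.1, p. 66] -/
theorem DeJong1996Projective.of_finiteSubextension45_of_fibration_of_stepVI
    (H : DeJong1996.FiniteSubextension45.{u}) (h₁ : DeJong1996FibrationReduction.{u})
    (h₂ : DeJong1996NormalProjectiveStepVI.{u}) : DeJong1996Projective.{u} :=
  (DeJong1996Strong.of_finiteSubextension45_of_fibration_of_stepVI H h₁ h₂).1.projective

end Literature.AlgebraicGeometry.Resolution

end
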